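import Literature.Analysis.FluidPDE.SteadyLiouvilleTsaiKit
import Literature.Analysis.FluidPDE.LerayProfileRegularity
import Literature.Analysis.FluidPDE.LerayProfileCalculus
import HarnessLib

/-!
# Tsai's annular Liouville theorem (Tsai 2021, Thm 1.1 (a)) — II: the system in coordinates and
# the localised vorticity in `L^p`

Analysis/FluidPDE support file (theorems only: no definitions, no named facts) on the discharge
path of the named fact `Literature.Analysis.FluidPDE.Tsai2021_annular_liouville`
(`SteadyLiouvilleCriteria.lean`; T.-P. Tsai, SN Partial Differ. Equ. Appl. 2 (2021), Paper
No. 10 = arXiv:2005.09691, Theorem 1.1 (a)), sequel of `SteadyLiouvilleTsaiKit.lean`.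

For a steady profile `(U, P)` of the tree (`IsLerayProfile ν 0 U P`: `U ∈ C²`, `P ∈ C¹`,
`−νΔU + (U·∇)U + ∇P = 0`, `div U = 0` pointwise on `(EuclideanSpace ℝ (Fin 3))`) with `U ∈ C^∞`:

* §1 coordinates of `DU`, `ΔU`, `∇P`, `(U·∇)U`, `div U` in the standard basis;
* §2 the pressure is `C^∞` (`∇P = νΔU − (U·∇)U`), the system in coordinates
  `νΔUᵢ = ∂ᵢP + Σₗ∂ₗ(UᵢUₗ)` (`component_eq`) and the **vorticity equation**
  `νΔ(∂ᵢUⱼ − ∂ⱼUᵢ) = Σₗ(∂ₗ∂ᵢ(UⱼUₗ) − ∂ₗ∂ⱼ(UᵢUₗ))` (`vorticity_eq`; the pressure drops out);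
* §3 **Step 1** of the pressure-independent interior estimate (Tsai 2021, Lemma 3.1 — there from
  Šverák–Tsai's interior `L^q` theory; here from Green's representation at a fixed scale
  `χω = N[Δ(χω)] + Λ[χω]` and the Calderón–Zygmund/Young operator bounds of the kit):
  `vorticity_cutoff_bound` — for a cut-off `χ ∈ C_c^∞` supported in `K`,
  `‖χ(∂ᵢUⱼ − ∂ⱼUᵢ)‖_{L^p((EuclideanSpace ℝ (Fin 3)))} ≤ C (‖U‖_{L^p(K)} + ‖U‖²_{L^{2p}(K)})`, `1 < p < ∞`,
  with `C` independent of the solution.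

## References

* T.-P. Tsai, SN Partial Differ. Equ. Appl. 2 (2021), Paper No. 10 (arXiv:2005.09691), §3,
  Lemma 3.1. [Tsai2021]
* T.-P. Tsai, Arch. Rational Mech. Anal. 143 (1998) 29–51, §2 p. 34 (smoothness of the pressure
  of a smooth profile). [Tsai1998]
-/

noncomputable section

open MeasureTheory Set Filter Function Metric InnerProductSpace Topology
open scoped ENNReal NNReal RealInnerProductSpace Laplacian ContDiff Convolution

namespace Literature.Analysis.FluidPDE

namespace Tsai2021

/-! ### §1. Coordinates of the profile system -/

section Components

variable {U : (EuclideanSpace ℝ (Fin 3)) → (EuclideanSpace ℝ (Fin 3))} {P : (EuclideanSpace ℝ (Fin 3)) → ℝ}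

/-- The basis vectors have norm `1`. [folklore] -/
theorem norm_single_one (i : Fin 3) : ‖(EuclideanSpace.single (i : Fin 3) (1 : ℝ))‖ = 1 := by simp

/-- A coordinate of a vector is its inner product with the basis vector. [folklore] -/
theorem apply_eq_inner_single (v : (EuclideanSpace ℝ (Fin 3))) (i : Fin 3) : v i = ⟪v, (EuclideanSpace.single (i : Fin 3) (1 : ℝ))⟫ := by
  simp [EuclideanSpace.inner_single_right]

/-- Coordinates of the derivative: `(DU(x)v)ᵢ = D(Uᵢ)(x)v`. [folklore] -/
theorem fderiv_apply_coord (hU : Differentiable ℝ U) (x v : (EuclideanSpace ℝ (Fin 3))) (i : Fin 3) :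
    fderiv ℝ U x v i = fderiv ℝ (fun y => U y i) x v := by
  have h : (fun y => U y i) = fun y => (EuclideanSpace.proj i : (EuclideanSpace ℝ (Fin 3)) →L[ℝ] ℝ) (U y) := rfl
  rw [h, fderiv_fun_comp x (EuclideanSpace.proj i : (EuclideanSpace ℝ (Fin 3)) →L[ℝ] ℝ).differentiableAt (hU x),
    ContinuousLinearMap.fderiv]
  rfl

/-- Coordinates of the Laplacian: `(ΔU)ᵢ = Δ(Uᵢ)`. [folklore] -/
theorem laplacian_apply_coord (hU : ContDiff ℝ 2 U) (x : (EuclideanSpace ℝ (Fin 3))) (i : Fin 3) :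
    (Δ U) x i = (Δ (fun y => U y i)) x := by
  have h : (fun y => U y i) = (EuclideanSpace.proj i : (EuclideanSpace ℝ (Fin 3)) →L[ℝ] ℝ) ∘ U := rfl
  rw [h, ContDiffAt.laplacian_CLM_comp_left hU.contDiffAt]
  rfl

/-- Coordinates of the gradient: `(∇P)ᵢ = ∂ᵢP`. [folklore] -/
theorem gradient_apply_coord (P : (EuclideanSpace ℝ (Fin 3)) → ℝ) (x : (EuclideanSpace ℝ (Fin 3))) (i : Fin 3) :
    gradient P x i = fderiv ℝ P x ((EuclideanSpace.single (i : Fin 3) (1 : ℝ))) := by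
  rw [apply_eq_inner_single, gradient, InnerProductSpace.toDual_symm_apply]

/-- Directional derivative along a vector, in coordinates: `D f(x) v = Σₗ vₗ ∂ₗ f(x)`.
This is the tree's `Literature.Analysis.FluidPDE.fderiv_apply_eq_sum_mul_pderiv`
(`NSVorticityEnergy.lean`, there with `pderiv l f x = D f(x) eₗ`) at `ι = Fin 3`; the name is kept
for the `Tsai2021` coordinate kit (`convect_apply_coord` rewrites with it). [folklore] -/
theorem fderiv_apply_eq_sum (f : (EuclideanSpace ℝ (Fin 3)) → ℝ) (x v : (EuclideanSpace ℝ (Fin 3))) :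
    fderiv ℝ f x v = ∑ l : Fin 3, v l * fderiv ℝ f x ((EuclideanSpace.single (l : Fin 3) (1 : ℝ))) :=
  fderiv_apply_eq_sum_mul_pderiv f x v

/-- The divergence in coordinates: `div U = Σₗ ∂ₗUₗ`. [folklore] -/
theorem divergence_eq_sum_coord (hU : Differentiable ℝ U) (x : (EuclideanSpace ℝ (Fin 3))) :
    VectorCalculus.divergence U x = ∑ l : Fin 3, fderiv ℝ (fun y => U y l) x ((EuclideanSpace.single (l : Fin 3) (1 : ℝ))) := by
  rw [divergence_eq_sum_inner_fderiv (EuclideanSpace.basisFun (Fin 3) ℝ) U x]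
  refine Finset.sum_congr rfl fun l _ => ?_
  rw [EuclideanSpace.basisFun_apply, real_inner_comm, ← apply_eq_inner_single,
    fderiv_apply_coord hU]

/-- The convective term in coordinates: `((U·∇)U)ᵢ = Σₗ Uₗ ∂ₗUᵢ`. [folklore] -/
theorem convect_apply_coord (hU : Differentiable ℝ U) (x : (EuclideanSpace ℝ (Fin 3))) (i : Fin 3) :
    convect U U x i = ∑ l : Fin 3, U x l * fderiv ℝ (fun y => U y i) x ((EuclideanSpace.single (l : Fin 3) (1 : ℝ))) := by
  rw [convect_apply, fderiv_apply_coord hU, fderiv_apply_eq_sum]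

end Components

/-! ### §2. The steady system in coordinates; smoothness of the pressure; the vorticity equation -/

section System

variable {ν : ℝ} {U : (EuclideanSpace ℝ (Fin 3)) → (EuclideanSpace ℝ (Fin 3))} {P : (EuclideanSpace ℝ (Fin 3)) → ℝ}

/-- For a steady profile (`a = 0`), `∇P = νΔU − (U·∇)U`. [folklore] -/
theorem gradient_eq_of_profile (hprof : IsLerayProfile ν 0 U P) :
    gradient P = fun x => ν • (Δ U) x - convect U U x := by
  funext x
  have hx := hprof.profile_eq x
  simp only [zero_smul, add_zero] at hx
  rw [← sub_eq_zero, ← hx]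
  abel

/-- **The pressure of a smooth steady profile is smooth** (`∇P = νΔU − (U·∇)U ∈ C^∞`). This is the
`a = 0` case of the tree's `IsLerayProfile.contDiff_pressure_of_smooth` (`TsaiHeadPressure.lean`);
the short name is kept for the `Tsai2021` files. [cite: Tsai1998, §2 (p. 34)] -/
theorem contDiff_pressure_top (hprof : IsLerayProfile ν 0 U P) (hU : ContDiff ℝ ∞ U) :
    ContDiff ℝ ∞ P :=
  hprof.contDiff_pressure_of_smooth hU

/-- **The steady system in coordinates**: `ν ΔUᵢ = ∂ᵢP + Σₗ ∂ₗ(UᵢUₗ)` (using `div U = 0`: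
`Σₗ Uₗ∂ₗUᵢ = Σₗ ∂ₗ(UᵢUₗ)`). [cite: Tsai2021, (1.1) and §3 ("F = −u ⊗ u")] -/
theorem component_eq (hprof : IsLerayProfile ν 0 U P) (hU : ContDiff ℝ ∞ U) (x : (EuclideanSpace ℝ (Fin 3))) (i : Fin 3) :
    ν * (Δ (fun y => U y i)) x =
      fderiv ℝ P x ((EuclideanSpace.single (i : Fin 3) (1 : ℝ))) + ∑ l : Fin 3, fderiv ℝ (fun y => U y i * U y l) x ((EuclideanSpace.single (l : Fin 3) (1 : ℝ))) := by
  have hUd : Differentiable ℝ U := hU.differentiable (by norm_cast)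
  have hUi : ∀ k : Fin 3, ContDiff ℝ 1 fun y => U y k := fun k =>
    (contDiff_euclidean.1 hU k).of_le (by norm_cast)
  have hx := hprof.profile_eq x
  simp only [zero_smul, add_zero] at hx
  have hvec : ν • (Δ U) x = convect U U x + gradient P x := by
    rw [← sub_eq_zero, ← neg_eq_zero, ← hx]; abel
  have hcoord := congrArg (fun v : (EuclideanSpace ℝ (Fin 3)) => v i) hvec
  simp only [PiLp.smul_apply, smul_eq_mul, PiLp.add_apply] at hcoord
  rw [laplacian_apply_coord (hU.of_le (by norm_cast)), convect_apply_coord hUd,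
    gradient_apply_coord] at hcoord
  rw [hcoord, add_comm]
  congr 1
  -- `Σₗ Uₗ ∂ₗUᵢ = Σₗ ∂ₗ(UᵢUₗ) − Uᵢ div U`
  have hdiv : ∑ l : Fin 3, fderiv ℝ (fun y => U y l) x ((EuclideanSpace.single (l : Fin 3) (1 : ℝ))) = 0 := by
    rw [← divergence_eq_sum_coord hUd]; exact hprof.divFree x
  have hsum : ∑ l : Fin 3, fderiv ℝ (fun y => U y i * U y l) x ((EuclideanSpace.single (l : Fin 3) (1 : ℝ))) =
      ∑ l : Fin 3, U x l * fderiv ℝ (fun y => U y i) x ((EuclideanSpace.single (l : Fin 3) (1 : ℝ))) +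
        U x i * ∑ l : Fin 3, fderiv ℝ (fun y => U y l) x ((EuclideanSpace.single (l : Fin 3) (1 : ℝ))) := by
    rw [Finset.mul_sum, ← Finset.sum_add_distrib]
    refine Finset.sum_congr rfl fun l _ => ?_
    rw [pd_mul_apply (hUi i) (hUi l)]
    ring
  rw [hsum, hdiv, mul_zero, add_zero]

/-- **The vorticity equation** of the steady system in coordinates: with
`ω_{ij} = ∂ᵢUⱼ − ∂ⱼUᵢ` and `F_{jl} = UⱼUₗ`,
`ν Δω_{ij} = Σₗ (∂ₗ∂ᵢF_{jl} − ∂ₗ∂ⱼF_{il})` (the pressure drops out by the symmetry of second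
derivatives). [cite: Tsai2021, §1 (comments on Thm 1.1: "pressure-independent")] -/
theorem vorticity_eq (hprof : IsLerayProfile ν 0 U P) (hU : ContDiff ℝ ∞ U) (hν : ν ≠ 0)
    (x : (EuclideanSpace ℝ (Fin 3))) (i j : Fin 3) :
    ν * (Δ (fun y => fderiv ℝ (fun z => U z j) y ((EuclideanSpace.single (i : Fin 3) (1 : ℝ))) - fderiv ℝ (fun z => U z i) y ((EuclideanSpace.single (j : Fin 3) (1 : ℝ))))) x =
      ∑ l : Fin 3, (fderiv ℝ (fun y => fderiv ℝ (fun z => U z j * U z l) y ((EuclideanSpace.single (i : Fin 3) (1 : ℝ)))) x ((EuclideanSpace.single (l : Fin 3) (1 : ℝ)))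
        - fderiv ℝ (fun y => fderiv ℝ (fun z => U z i * U z l) y ((EuclideanSpace.single (j : Fin 3) (1 : ℝ)))) x ((EuclideanSpace.single (l : Fin 3) (1 : ℝ)))) := by
  have hP : ContDiff ℝ ∞ P := contDiff_pressure_top hprof hU
  have hUi : ∀ k : Fin 3, ContDiff ℝ ∞ fun y => U y k := fun k => contDiff_euclidean.1 hU k
  have hF : ∀ k l : Fin 3, ContDiff ℝ ∞ fun y => U y k * U y l := fun k l => (hUi k).mul (hUi l)
  -- `ΔU_k = ν⁻¹ G_k` as functions
  set G : Fin 3 → (EuclideanSpace ℝ (Fin 3)) → ℝ := fun k x =>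
    fderiv ℝ P x ((EuclideanSpace.single (k : Fin 3) (1 : ℝ))) + ∑ l : Fin 3, fderiv ℝ (fun y => U y k * U y l) x ((EuclideanSpace.single (l : Fin 3) (1 : ℝ))) with hG
  have hGs : ∀ k, ContDiff ℝ ∞ (G k) := fun k =>
    (contDiff_pd hP _).add (ContDiff.sum fun l _ => contDiff_pd (hF k l) _)
  have hΔU : ∀ k, Δ (fun y => U y k) = fun x => ν⁻¹ * G k x := fun k => by
    funext x
    have := component_eq hprof hU x k
    rw [hG]
    field_simp
    linarith
  -- derivative of `G k` along `e m`
  have hDG : ∀ k (m : Fin 3), fderiv ℝ (G k) x ((EuclideanSpace.single (m : Fin 3) (1 : ℝ))) =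
      fderiv ℝ (fun y => fderiv ℝ P y ((EuclideanSpace.single (k : Fin 3) (1 : ℝ)))) x ((EuclideanSpace.single (m : Fin 3) (1 : ℝ))) +
        ∑ l : Fin 3, fderiv ℝ (fun y => fderiv ℝ (fun z => U z k * U z l) y ((EuclideanSpace.single (l : Fin 3) (1 : ℝ)))) x ((EuclideanSpace.single (m : Fin 3) (1 : ℝ))) := by
    intro k m
    have hd1 : DifferentiableAt ℝ (fun y => fderiv ℝ P y ((EuclideanSpace.single (k : Fin 3) (1 : ℝ)))) x :=
      (contDiff_pd hP _).differentiable (by norm_cast) x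
    have hd2 : ∀ l ∈ (Finset.univ : Finset (Fin 3)),
        DifferentiableAt ℝ (fun y => fderiv ℝ (fun z => U z k * U z l) y ((EuclideanSpace.single (l : Fin 3) (1 : ℝ)))) x :=
      fun l _ => (contDiff_pd (hF k l) _).differentiable (by norm_cast) x
    rw [hG]
    rw [fderiv_fun_add hd1 (DifferentiableAt.fun_sum hd2), fderiv_fun_sum hd2]
    simp only [add_apply, FunLike.coe_sum, Finset.sum_apply]
  -- the Laplacian of the vorticity
  have hω1 : ContDiff ℝ ∞ fun y => fderiv ℝ (fun z => U z j) y ((EuclideanSpace.single (i : Fin 3) (1 : ℝ))) := contDiff_pd (hUi j) _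
  have hω2 : ContDiff ℝ ∞ fun y => fderiv ℝ (fun z => U z i) y ((EuclideanSpace.single (j : Fin 3) (1 : ℝ))) := contDiff_pd (hUi i) _
  have hΔω : (Δ (fun y => fderiv ℝ (fun z => U z j) y ((EuclideanSpace.single (i : Fin 3) (1 : ℝ))) - fderiv ℝ (fun z => U z i) y ((EuclideanSpace.single (j : Fin 3) (1 : ℝ))))) x
      = (Δ (fun y => fderiv ℝ (fun z => U z j) y ((EuclideanSpace.single (i : Fin 3) (1 : ℝ))))) x
        - (Δ (fun y => fderiv ℝ (fun z => U z i) y ((EuclideanSpace.single (j : Fin 3) (1 : ℝ))))) x := by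
    have h2a : ContDiff ℝ 2 fun y => fderiv ℝ (fun z => U z j) y ((EuclideanSpace.single (i : Fin 3) (1 : ℝ))) := hω1.of_le (by norm_cast)
    have h2b : ContDiff ℝ 2 fun y => fderiv ℝ (fun z => U z i) y ((EuclideanSpace.single (j : Fin 3) (1 : ℝ))) := hω2.of_le (by norm_cast)
    exact ContDiffAt.laplacian_sub h2a.contDiffAt h2b.contDiffAt
  -- `Δ ∂ₘU_k = ∂ₘ ΔU_k = ν⁻¹ ∂ₘ G_k`
  have hkey : ∀ k m : Fin 3, (Δ (fun y => fderiv ℝ (fun z => U z k) y ((EuclideanSpace.single (m : Fin 3) (1 : ℝ))))) x =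
      ν⁻¹ * fderiv ℝ (G k) x ((EuclideanSpace.single (m : Fin 3) (1 : ℝ))) := by
    intro k m
    rw [← fderiv_laplacian_apply ((hUi k).of_le (by norm_cast)) x ((EuclideanSpace.single (m : Fin 3) (1 : ℝ))), hΔU k,
      fderiv_const_mul ((hGs k).differentiable (by norm_cast) x) ν⁻¹]
    simp only [FunLike.coe_smul, Pi.smul_apply, smul_eq_mul]
  have hP2 : ContDiff ℝ 2 P := hP.of_le (by norm_cast)
  have hF2 : ∀ k l : Fin 3, ContDiff ℝ 2 fun y => U y k * U y l := fun k l => (hF k l).of_le (by norm_cast)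
  rw [hΔω, hkey j i, hkey i j, hDG j i, hDG i j, fderiv_fderiv_apply_comm hP2 x ((EuclideanSpace.single (i : Fin 3) (1 : ℝ))) ((EuclideanSpace.single (j : Fin 3) (1 : ℝ))),
    ← mul_sub, ← mul_assoc, mul_inv_cancel₀ hν, one_mul, Finset.sum_sub_distrib]
  have e1 : ∑ l : Fin 3, fderiv ℝ (fun y => fderiv ℝ (fun z => U z j * U z l) y ((EuclideanSpace.single (l : Fin 3) (1 : ℝ)))) x ((EuclideanSpace.single (i : Fin 3) (1 : ℝ))) =
      ∑ l : Fin 3, fderiv ℝ (fun y => fderiv ℝ (fun z => U z j * U z l) y ((EuclideanSpace.single (i : Fin 3) (1 : ℝ)))) x ((EuclideanSpace.single (l : Fin 3) (1 : ℝ))) :=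
    Finset.sum_congr rfl fun l _ => fderiv_fderiv_apply_comm (hF2 j l) x ((EuclideanSpace.single (i : Fin 3) (1 : ℝ))) ((EuclideanSpace.single (l : Fin 3) (1 : ℝ)))
  have e2 : ∑ l : Fin 3, fderiv ℝ (fun y => fderiv ℝ (fun z => U z i * U z l) y ((EuclideanSpace.single (l : Fin 3) (1 : ℝ)))) x ((EuclideanSpace.single (j : Fin 3) (1 : ℝ))) =
      ∑ l : Fin 3, fderiv ℝ (fun y => fderiv ℝ (fun z => U z i * U z l) y ((EuclideanSpace.single (j : Fin 3) (1 : ℝ)))) x ((EuclideanSpace.single (l : Fin 3) (1 : ℝ))) :=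
    Finset.sum_congr rfl fun l _ => fderiv_fderiv_apply_comm (hF2 i l) x ((EuclideanSpace.single (j : Fin 3) (1 : ℝ))) ((EuclideanSpace.single (l : Fin 3) (1 : ℝ)))
  rw [e1, e2]
  ring

end System

/-! ### §3. Step 1: the localised vorticity in `L^p` -/

section Vorticity

variable {ν : ℝ} {r₀ r₁ : ℝ} {p : ℝ≥0∞}

/-- All the cut-off data of `χ ∈ C_c^∞` — `χ`, `∂ₗχ`, `Δχ` and their first two derivatives —
are bounded by one constant. [folklore] -/
theorem exists_cutoff_bound {χ : (EuclideanSpace ℝ (Fin 3)) → ℝ} (hχ : ContDiff ℝ ∞ χ) (hχc : HasCompactSupport χ) :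
    ∃ M : ℝ, 0 ≤ M ∧
      ((∀ x, |χ x| ≤ M) ∧ (∀ x, ‖fderiv ℝ χ x‖ ≤ M) ∧ (∀ x, ‖fderiv ℝ (fderiv ℝ χ) x‖ ≤ M)) ∧
      (∀ l : Fin 3, (∀ x, |fderiv ℝ χ x ((EuclideanSpace.single (l : Fin 3) (1 : ℝ)))| ≤ M) ∧
        (∀ x, ‖fderiv ℝ (fun y => fderiv ℝ χ y ((EuclideanSpace.single (l : Fin 3) (1 : ℝ)))) x‖ ≤ M) ∧
        (∀ x, ‖fderiv ℝ (fderiv ℝ (fun y => fderiv ℝ χ y ((EuclideanSpace.single (l : Fin 3) (1 : ℝ))))) x‖ ≤ M)) ∧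
      ((∀ x, |(Δ χ) x| ≤ M) ∧ (∀ x, ‖fderiv ℝ (Δ χ) x‖ ≤ M) ∧
        (∀ x, ‖fderiv ℝ (fderiv ℝ (Δ χ)) x‖ ≤ M)) := by
  obtain ⟨M₀, hM₀, h00, h01, h02⟩ := exists_bound_two (hχ.of_le (by norm_cast)) hχc
  have hl : ∀ l : Fin 3, ∃ M : ℝ, 0 ≤ M ∧ (∀ x, |fderiv ℝ χ x ((EuclideanSpace.single (l : Fin 3) (1 : ℝ)))| ≤ M) ∧
      (∀ x, ‖fderiv ℝ (fun y => fderiv ℝ χ y ((EuclideanSpace.single (l : Fin 3) (1 : ℝ)))) x‖ ≤ M) ∧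
      (∀ x, ‖fderiv ℝ (fderiv ℝ (fun y => fderiv ℝ χ y ((EuclideanSpace.single (l : Fin 3) (1 : ℝ))))) x‖ ≤ M) := fun l =>
    exists_bound_two ((contDiff_pd hχ _).of_le (by norm_cast)) (hasCompactSupport_pd hχc _)
  choose Ml hMl hl0 hl1 hl2 using hl
  obtain ⟨Md, hMd, hd0, hd1, hd2⟩ := exists_bound_two ((contDiff_laplacian (n := ⊤) hχ).of_le (by norm_cast))
    (hasCompactSupport_laplacian hχc)
  set M := M₀ + (∑ k : Fin 3, Ml k) + Md with hM
  have hsum : 0 ≤ ∑ k : Fin 3, Ml k := Finset.sum_nonneg fun k _ => hMl k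
  have hMl' : ∀ l : Fin 3, Ml l ≤ M := by
    intro l
    have h := Finset.single_le_sum (fun k _ => hMl k) (Finset.mem_univ l)
    simp only [hM]; linarith
  have hM₀' : M₀ ≤ M := by simp only [hM]; linarith
  have hMd' : Md ≤ M := by simp only [hM]; linarith
  refine ⟨M, hM₀.trans hM₀', ⟨fun x => (h00 x).trans hM₀', fun x => (h01 x).trans hM₀',
    fun x => (h02 x).trans hM₀'⟩, fun l => ⟨fun x => (hl0 l x).trans (hMl' l),
    fun x => (hl1 l x).trans (hMl' l), fun x => (hl2 l x).trans (hMl' l)⟩,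
    ⟨fun x => (hd0 x).trans hMd', fun x => (hd1 x).trans hMd', fun x => (hd2 x).trans hMd'⟩⟩

/-- **Step 1 (the localised vorticity is controlled in `L^p` by the velocity alone).** For
`ν > 0`, radii `0 < r₀ < r₁`, `1 < p < ∞` and a cut-off `χ ∈ C_c^∞` supported in the measurable
set `K`, there is `C` such that for every smooth steady profile `(U, P)` (`IsLerayProfile ν 0 U P`)
and all `i, j`,
`‖χ (∂ᵢUⱼ − ∂ⱼUᵢ)‖_{L^p((EuclideanSpace ℝ (Fin 3)))} ≤ C (‖U‖_{L^p(K)} + ‖U‖²_{L^{2p}(K)})`.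
This is the vorticity half of the pressure-independent interior estimate of Šverák–Tsai
(Tsai 2021, Lemma 3.1 with `q = m`), proved here with the truncated Newtonian potential:
`χω = N[Δ(χω)] + Λ[χω]`, the vorticity equation `νΔω_{ij} = Σₗ ∂ₗ(∂ᵢF_{jl} − ∂ⱼF_{il})`,
`F = U ⊗ U`, and the operator bounds (N0)–(N2), (Λ0)–(Λ1) after moving the cut-offs through the
derivatives. [cite: Tsai2021, Lemma 3.1 (pressure-independent interior estimate)] -/
theorem vorticity_cutoff_bound (hν : 0 < ν) (h₀ : 0 < r₀) (h₁ : r₀ < r₁) (hp : 1 < p)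
    (hp' : p < ⊤) {χ : (EuclideanSpace ℝ (Fin 3)) → ℝ} (hχ : ContDiff ℝ ∞ χ) (hχc : HasCompactSupport χ) {K : Set (EuclideanSpace ℝ (Fin 3))}
    (hK : MeasurableSet K) (hχK : tsupport χ ⊆ K) :
    ∃ C : ℝ≥0, ∀ (U : (EuclideanSpace ℝ (Fin 3)) → (EuclideanSpace ℝ (Fin 3))) (P : (EuclideanSpace ℝ (Fin 3)) → ℝ), IsLerayProfile ν 0 U P → ContDiff ℝ ∞ U →
      ∀ i j : Fin 3,
        eLpNorm (fun x => χ x * (fderiv ℝ (fun y => U y j) x ((EuclideanSpace.single (i : Fin 3) (1 : ℝ))) - fderiv ℝ (fun y => U y i) x ((EuclideanSpace.single (j : Fin 3) (1 : ℝ)))))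
          p volume ≤
        C * (eLpNorm U p (volume.restrict K) + eLpNorm U (2 * p) (volume.restrict K) ^ (2 : ℝ)) := by
  have hp1 : 1 ≤ p := hp.le
  obtain ⟨C, hN0, hN1, hN2, hΛ0, hΛ1⟩ := exists_operator_bounds h₀ h₁ hp hp'
  obtain ⟨M, hM0, ⟨hχ0, hχ1, hχ2⟩, hχl, ⟨hd0, hd1, hd2⟩⟩ := exists_cutoff_bound hχ hχc
  refine ⟨C * M.toNNReal * (24 * ν⁻¹ + 56).toNNReal, fun U P hprof hU i j => ?_⟩
  have he : ∀ l : Fin 3, ‖(EuclideanSpace.single (l : Fin 3) (1 : ℝ))‖ ≤ 1 := fun l => (norm_single_one l).le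
  have hUi : ∀ k : Fin 3, ContDiff ℝ ∞ fun y => U y k := fun k => contDiff_euclidean.1 hU k
  have hF : ∀ k l : Fin 3, ContDiff ℝ ∞ fun y => U y k * U y l := fun k l => (hUi k).mul (hUi l)
  have hχ2' : ContDiff ℝ 2 χ := hχ.of_le (by norm_cast)
  -- the data of `χ`: `∂ₗχ` and `Δχ` are again smooth cut-offs supported in `K`
  have hψl : ∀ l : Fin 3, ContDiff ℝ ∞ fun y => fderiv ℝ χ y ((EuclideanSpace.single (l : Fin 3) (1 : ℝ))) := fun l => contDiff_pd hχ _
  have hψlc : ∀ l : Fin 3, HasCompactSupport fun y => fderiv ℝ χ y ((EuclideanSpace.single (l : Fin 3) (1 : ℝ))) := fun l =>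
    hasCompactSupport_pd hχc _
  have hψlK : ∀ l : Fin 3, tsupport (fun y => fderiv ℝ χ y ((EuclideanSpace.single (l : Fin 3) (1 : ℝ)))) ⊆ K := fun l =>
    (tsupport_pd_subset χ _).trans hχK
  have hΔχ : ContDiff ℝ ∞ (Δ χ) := contDiff_laplacian hχ
  have hΔχK : tsupport (Δ χ) ⊆ K := (tsupport_laplacian_subset χ).trans hχK
  -- abbreviations
  set B : ℝ≥0∞ := eLpNorm U p (volume.restrict K) + eLpNorm U (2 * p) (volume.restrict K) ^ (2 : ℝ)
    with hB
  set X : ℝ≥0∞ := C * ENNReal.ofReal M * B with hX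
  have hBu : ∀ k : Fin 3, eLpNorm (fun y => U y k) p (volume.restrict K) ≤ B := fun k =>
    (eLpNorm_apply_le U k p _).trans le_self_add
  have hBF : ∀ k l : Fin 3, eLpNorm (fun y => U y k * U y l) p (volume.restrict K) ≤ B := fun k l =>
    (eLpNorm_apply_mul_apply_le U k l p _).trans le_add_self
  have hXu : ∀ k : Fin 3, C * ENNReal.ofReal M * eLpNorm (fun y => U y k) p (volume.restrict K) ≤ X :=
    fun k => by rw [hX]; gcongr; exact hBu k
  have hXF : ∀ k l : Fin 3,
      C * ENNReal.ofReal M * eLpNorm (fun y => U y k * U y l) p (volume.restrict K) ≤ X :=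
    fun k l => by rw [hX]; gcongr; exact hBF k l
  -- the vorticity and its localisation
  set vort : (EuclideanSpace ℝ (Fin 3)) → ℝ := fun x => fderiv ℝ (fun y => U y j) x ((EuclideanSpace.single (i : Fin 3) (1 : ℝ))) - fderiv ℝ (fun y => U y i) x ((EuclideanSpace.single (j : Fin 3) (1 : ℝ)))
    with hvort
  have hvorts : ContDiff ℝ ∞ vort := (contDiff_pd (hUi j) _).sub (contDiff_pd (hUi i) _)
  have hΩs : ContDiff ℝ ∞ fun x => χ x * vort x := hχ.mul hvorts
  have hrep : (fun x => χ x * vort x) = fun x =>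
      newtonNearPotential r₀ r₁ (Δ fun y => χ y * vort y) x + newtonFarSmoothing r₀ r₁ (fun y => χ y * vort y) x :=
    funext fun x => eq_newtonNearPotential_laplacian_add h₀ h₁ (hΩs.of_le (by norm_cast)) x
  have hgoal : (fun x => χ x * (fderiv ℝ (fun y => U y j) x ((EuclideanSpace.single (i : Fin 3) (1 : ℝ))) - fderiv ℝ (fun y => U y i) x ((EuclideanSpace.single (j : Fin 3) (1 : ℝ)))))
      = fun x => χ x * vort x := rfl
  rw [hgoal, hrep]
  ----------------------------------------------------------------
  -- (I) the smoothing part `Λ[χω]`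
  ----------------------------------------------------------------
  have hΛpart : eLpNorm (newtonFarSmoothing r₀ r₁ fun y => χ y * vort y) p volume ≤ 2 * X + 2 * X := by
    have hsplit : (fun y => χ y * vort y) = fun y =>
        χ y * fderiv ℝ (fun z => U z j) y ((EuclideanSpace.single (i : Fin 3) (1 : ℝ))) - χ y * fderiv ℝ (fun z => U z i) y ((EuclideanSpace.single (j : Fin 3) (1 : ℝ))) :=
      funext fun y => by rw [hvort]; ring
    rw [hsplit]
    refine (eLpNorm_newtonFarSmoothing_sub_le h₀ h₁ hp1
      (hχ.continuous.mul (contDiff_pd (hUi j) _).continuous)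
      (hχ.continuous.mul (contDiff_pd (hUi i) _).continuous)).trans ?_
    refine add_le_add ?_ ?_
    · exact (eLpNorm_newtonFarSmoothing_mul_pd_le h₀ h₁ hp1 hΛ0 hΛ1 hχ hK hχK hχ0 hχ1 (hUi j)
        (he i)).trans (by gcongr; exact hXu j)
    · exact (eLpNorm_newtonFarSmoothing_mul_pd_le h₀ h₁ hp1 hΛ0 hΛ1 hχ hK hχK hχ0 hχ1 (hUi i)
        (he j)).trans (by gcongr; exact hXu i)
  ----------------------------------------------------------------
  -- (II) the expansion of `Δ(χω)`
  ----------------------------------------------------------------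
  set T1 : Fin 3 → (EuclideanSpace ℝ (Fin 3)) → ℝ := fun l x =>
    χ x * fderiv ℝ (fun y => fderiv ℝ (fun z => U z j * U z l) y ((EuclideanSpace.single (i : Fin 3) (1 : ℝ)))) x ((EuclideanSpace.single (l : Fin 3) (1 : ℝ))) with hT1
  set T2 : Fin 3 → (EuclideanSpace ℝ (Fin 3)) → ℝ := fun l x =>
    χ x * fderiv ℝ (fun y => fderiv ℝ (fun z => U z i * U z l) y ((EuclideanSpace.single (j : Fin 3) (1 : ℝ)))) x ((EuclideanSpace.single (l : Fin 3) (1 : ℝ))) with hT2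
  set T3 : Fin 3 → (EuclideanSpace ℝ (Fin 3)) → ℝ := fun l x =>
    fderiv ℝ χ x ((EuclideanSpace.single (l : Fin 3) (1 : ℝ))) * fderiv ℝ (fun y => fderiv ℝ (fun z => U z j) y ((EuclideanSpace.single (i : Fin 3) (1 : ℝ)))) x ((EuclideanSpace.single (l : Fin 3) (1 : ℝ))) with hT3
  set T4 : Fin 3 → (EuclideanSpace ℝ (Fin 3)) → ℝ := fun l x =>
    fderiv ℝ χ x ((EuclideanSpace.single (l : Fin 3) (1 : ℝ))) * fderiv ℝ (fun y => fderiv ℝ (fun z => U z i) y ((EuclideanSpace.single (j : Fin 3) (1 : ℝ)))) x ((EuclideanSpace.single (l : Fin 3) (1 : ℝ))) with hT4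
  set T5 : (EuclideanSpace ℝ (Fin 3)) → ℝ := fun x => (Δ χ) x * fderiv ℝ (fun y => U y j) x ((EuclideanSpace.single (i : Fin 3) (1 : ℝ))) with hT5
  set T6 : (EuclideanSpace ℝ (Fin 3)) → ℝ := fun x => (Δ χ) x * fderiv ℝ (fun y => U y i) x ((EuclideanSpace.single (j : Fin 3) (1 : ℝ))) with hT6
  set S1 : (EuclideanSpace ℝ (Fin 3)) → ℝ := fun x => ∑ l : Fin 3, (T1 l x - T2 l x) with hS1
  set S2 : (EuclideanSpace ℝ (Fin 3)) → ℝ := fun x => ∑ l : Fin 3, (T3 l x - T4 l x) with hS2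
  set S3 : (EuclideanSpace ℝ (Fin 3)) → ℝ := fun x => T5 x - T6 x with hS3
  have hT1c : ∀ l, Continuous (T1 l) := fun l =>
    hχ.continuous.mul (contDiff_pd (contDiff_pd (hF j l) _) _).continuous
  have hT2c : ∀ l, Continuous (T2 l) := fun l =>
    hχ.continuous.mul (contDiff_pd (contDiff_pd (hF i l) _) _).continuous
  have hT3c : ∀ l, Continuous (T3 l) := fun l =>
    (hψl l).continuous.mul (contDiff_pd (contDiff_pd (hUi j) _) _).continuous
  have hT4c : ∀ l, Continuous (T4 l) := fun l =>
    (hψl l).continuous.mul (contDiff_pd (contDiff_pd (hUi i) _) _).continuous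
  have hT5c : Continuous T5 := hΔχ.continuous.mul (contDiff_pd (hUi j) _).continuous
  have hT6c : Continuous T6 := hΔχ.continuous.mul (contDiff_pd (hUi i) _).continuous
  have hS1c : Continuous S1 := continuous_finsetSum _ fun l _ => (hT1c l).sub (hT2c l)
  have hS2c : Continuous S2 := continuous_finsetSum _ fun l _ => (hT3c l).sub (hT4c l)
  have hS3c : Continuous S3 := hT5c.sub hT6c
  have hS1c' : Continuous fun x => ν⁻¹ * S1 x := continuous_const.mul hS1c
  have hS2c' : Continuous fun x => 2 * S2 x := continuous_const.mul hS2c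
  have hS23c : Continuous fun x => 2 * S2 x + S3 x := hS2c'.add hS3c
  have hallc : Continuous fun x => ν⁻¹ * S1 x + (2 * S2 x + S3 x) := hS1c'.add hS23c
  have hexp : (Δ fun y => χ y * vort y) = fun x => ν⁻¹ * S1 x + (2 * S2 x + S3 x) := by
    funext x
    rw [laplacian_mul_eq hχ2' (hvorts.of_le (by norm_cast)) x]
    -- `Δω = ν⁻¹ Σₗ (Aₗ − A'ₗ)`
    have hv := vorticity_eq hprof hU hν.ne' x i j
    have ha : (Δ vort) x = ν⁻¹ * ∑ l : Fin 3,
        (fderiv ℝ (fun y => fderiv ℝ (fun z => U z j * U z l) y ((EuclideanSpace.single (i : Fin 3) (1 : ℝ)))) x ((EuclideanSpace.single (l : Fin 3) (1 : ℝ)))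
          - fderiv ℝ (fun y => fderiv ℝ (fun z => U z i * U z l) y ((EuclideanSpace.single (j : Fin 3) (1 : ℝ)))) x ((EuclideanSpace.single (l : Fin 3) (1 : ℝ)))) := by
      rw [hvort, ← hv, ← mul_assoc, inv_mul_cancel₀ hν.ne', one_mul]
    -- `∂ₗω = ∂ₗ∂ᵢUⱼ − ∂ₗ∂ⱼUᵢ`
    have hb : ∀ l : Fin 3, fderiv ℝ vort x ((EuclideanSpace.single (l : Fin 3) (1 : ℝ))) =
        fderiv ℝ (fun y => fderiv ℝ (fun z => U z j) y ((EuclideanSpace.single (i : Fin 3) (1 : ℝ)))) x ((EuclideanSpace.single (l : Fin 3) (1 : ℝ)))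
          - fderiv ℝ (fun y => fderiv ℝ (fun z => U z i) y ((EuclideanSpace.single (j : Fin 3) (1 : ℝ)))) x ((EuclideanSpace.single (l : Fin 3) (1 : ℝ))) := by
      intro l
      rw [hvort, fderiv_fun_sub ((contDiff_pd (hUi j) _).differentiable (by norm_cast) x)
        ((contDiff_pd (hUi i) _).differentiable (by norm_cast) x)]
      rfl
    rw [ha]
    simp only [hb, hS1, hS2, hS3, hT1, hT2, hT3, hT4, hT5, hT6, Finset.mul_sum, mul_sub,
      Finset.sum_sub_distrib]
    rw [hvort]
    ring
  ----------------------------------------------------------------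
  -- (III) the potential part `N[Δ(χω)]`
  ----------------------------------------------------------------
  have hNpart : eLpNorm (newtonNearPotential r₀ r₁ (Δ fun y => χ y * vort y)) p volume ≤
      ENNReal.ofReal ν⁻¹ * (∑ _l : Fin 3, (4 * X + 4 * X)) +
        (2 * (∑ _l : Fin 3, (4 * X + 4 * X)) + (2 * X + 2 * X)) := by
    rw [hexp]
    refine (eLpNorm_newtonNearPotential_add_le h₀.le h₁ hp1 hS1c' hS23c).trans ?_
    refine add_le_add ?_ ((eLpNorm_newtonNearPotential_add_le h₀.le h₁ hp1
      hS2c' hS3c).trans (add_le_add ?_ ?_))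
    · rw [eLpNorm_newtonNearPotential_const_mul, Real.enorm_eq_ofReal (inv_nonneg.2 hν.le)]
      gcongr
      rw [hS1]
      refine (eLpNorm_newtonNearPotential_sum_sub_le h₀.le h₁ hp1 _ hT1c hT2c).trans ?_
      refine Finset.sum_le_sum fun l _ => add_le_add ?_ ?_
      · exact (eLpNorm_newtonNearPotential_mul_pd_pd_le h₀ h₁ hp1 hN0 hN1 hN2 hχ hχc hK hχK
          hχ0 hχ1 hχ2 (hF j l) (he l) (he i)).trans (by gcongr; exact hXF j l)
      · exact (eLpNorm_newtonNearPotential_mul_pd_pd_le h₀ h₁ hp1 hN0 hN1 hN2 hχ hχc hK hχK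
          hχ0 hχ1 hχ2 (hF i l) (he l) (he j)).trans (by gcongr; exact hXF i l)
    · rw [eLpNorm_newtonNearPotential_const_mul]
      have e2 : ‖(2 : ℝ)‖ₑ = 2 := by
        rw [Real.enorm_eq_ofReal zero_le_two]; norm_num
      rw [e2]
      gcongr
      rw [hS2]
      refine (eLpNorm_newtonNearPotential_sum_sub_le h₀.le h₁ hp1 _ hT3c hT4c).trans ?_
      refine Finset.sum_le_sum fun l _ => add_le_add ?_ ?_
      · obtain ⟨hl0, hl1, hl2⟩ := hχl l
        exact (eLpNorm_newtonNearPotential_mul_pd_pd_le h₀ h₁ hp1 hN0 hN1 hN2 (hψl l) (hψlc l) hK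
          (hψlK l) hl0 hl1 hl2 (hUi j) (he l) (he i)).trans (by gcongr; exact hXu j)
      · obtain ⟨hl0, hl1, hl2⟩ := hχl l
        exact (eLpNorm_newtonNearPotential_mul_pd_pd_le h₀ h₁ hp1 hN0 hN1 hN2 (hψl l) (hψlc l) hK
          (hψlK l) hl0 hl1 hl2 (hUi i) (he l) (he j)).trans (by gcongr; exact hXu i)
    · rw [hS3]
      refine (eLpNorm_newtonNearPotential_sub_le h₀.le h₁ hp1 hT5c hT6c).trans (add_le_add ?_ ?_)
      · exact (eLpNorm_newtonNearPotential_mul_pd_le h₀ h₁ hp1 hN0 hN1 hΔχ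
          (hasCompactSupport_laplacian hχc) hK hΔχK hd0 hd1 (hUi j) (he i)).trans
          (by gcongr; exact hXu j)
      · exact (eLpNorm_newtonNearPotential_mul_pd_le h₀ h₁ hp1 hN0 hN1 hΔχ
          (hasCompactSupport_laplacian hχc) hK hΔχK hd0 hd1 (hUi i) (he j)).trans
          (by gcongr; exact hXu i)
  ----------------------------------------------------------------
  -- (IV) collecting
  ----------------------------------------------------------------
  have hm1 : AEStronglyMeasurable (newtonNearPotential r₀ r₁ (Δ fun y => χ y * vort y)) volume := by
    rw [hexp]
    exact (continuous_newtonNearPotential h₀.le h₁ hallc).aestronglyMeasurable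
  have hm2 : AEStronglyMeasurable (newtonFarSmoothing r₀ r₁ fun y => χ y * vort y) volume :=
    (continuous_newtonFarSmoothing h₀ h₁ hΩs.continuous).aestronglyMeasurable
  refine (eLpNorm_add_le hm1 hm2 hp1).trans ((add_le_add hNpart hΛpart).trans ?_)
  simp only [Finset.sum_const, Finset.card_univ, Fintype.card_fin, nsmul_eq_mul, Nat.cast_ofNat]
  have hconst : ((C * M.toNNReal * (24 * ν⁻¹ + 56).toNNReal : ℝ≥0) : ℝ≥0∞) * B =
      ENNReal.ofReal (24 * ν⁻¹ + 56) * X := by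
    rw [hX, ENNReal.coe_mul, ENNReal.coe_mul]
    simp only [ENNReal.ofReal]
    ring
  rw [hconst, ENNReal.ofReal_add (by positivity) (by norm_num), ENNReal.ofReal_mul (by norm_num),
    ENNReal.ofReal_ofNat, ENNReal.ofReal_ofNat]
  apply le_of_eq
  ring

end Vorticity



end Tsai2021

end Literature.Analysis.FluidPDE

end
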